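import Literature.AnabelianGeometry.EtaleTheta.ThetaCohomology
import Literature.AnabelianGeometry.EtaleTheta.KummerContH1

/-!
# [EtTh] Prop. 1.4 (iii), first sentence: the étale theta classes as Kummer classes of `Θ̈`

Mochizuki, *The étale theta function …*, Publ. RIMS **45** (2009), Prop. 1.4 (iii), PRIMS PDF p. 22
(printed 248): "The classes `O^×_K̈ · η̈^Θ ∈ H¹(Π^tp_Ÿ, Δ_Θ)` … are precisely the 'Kummer classes'
associated to `O^×_K̈`-multiples of `Θ̈`, regarded as a regular function on `Ÿ`"
[cite: MochizukiEtTh2009, Prop 1.4 (iii) p.22]. Discharge companion (seat abc-iut-L2-t12) of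
`ThetaCohomology.lean` (abc-iut-L2-t1), which types this sentence as the predicate
`ThetaSetting.Prop14iiiKummer E κΘ̈` RELATIVE to a datum `κΘ̈ ∈ H¹(Π^tp_Ÿ, Δ_Θ)` ("the Kummer map of
FUNCTIONS is … not modelled here"). This file does three things, touching no statement of t1's files:

1. `prop14iiiKummer_iff` — AS TYPED the predicate is equivalent to "`κΘ̈` is one of the theta classes"
   (`κΘ̈ ∈ E.thetaClasses`): pure group theory of cosets of `O^×_K̈ · (–)` (PROVED both ways; in
   particular `prop14iiiKummer_etaDd`: it holds for `κΘ̈ := η̈^Θ` itself). So the printed content lives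
   entirely in the choice of `κΘ̈`, which the statement file leaves free.
2. `ThetaKummerInput` + `ThetaKummerInput.kummerTheta` — THE REAL `κΘ̈`: the Kummer class of `Θ̈` in
   t1's continuous `H¹(Π^tp_Ÿ, Δ_Θ) = ContH1 toTheta Δ_Θ Π^tp_Ÿ`, built with the Kummer bridge
   (`CyclotomeCoefficients.kummerContClass`, `KummerContH1.lean`) from geometric DATA: a multiplicative
   group `Fn` of functions with `Π^tp_X`-action and open stabilisers (functions on the tempered
   coverings), `Θ̈ ∈ Fn` fixed by `Π^tp_Ÿ` with a compatible system of roots on the coverings, the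
   constants `K̈^× → Fn` with roots, and the identification `Λ(Fn) = Ẑ(1) ≅ Δ_Θ` as
   `CyclotomeCoefficients toTheta Δ_Θ Fn` (p. 12, "`Δ_Θ ≅ Ẑ(1)`"). Independence of the roots
   (`kummerTheta_eq`), and the KEY COMPUTATION `kummer_const_mul_theta`: the Kummer class of `c · Θ̈` is
   `κ(c) · κΘ̈` (`kummerContClass_mul`).
3. `kummerUnitMultiples_eq` — under the one compatibility hypothesis `ConstCompat` (t1's abstract
   Kummer injection `kumYdd` of constants agrees with the bridge's Kummer classes of constants), the set
   of Kummer classes of the `O^×_K̈`-multiples of `Θ̈` IS the set `O^×_K̈ · κΘ̈`; hence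
   (`prop14iiiKummer_of_etaDd_eq`) Prop. 1.4 (iii)'s first sentence holds as typed as soon as `η̈^Θ` is
   (taken to be) the Kummer class of `Θ̈` — which is how p. 21 characterises it. REPORT (R-8/R-9 class,
   for abc-iut-L2-t1 / L2-lead, no defect claimed): with `etaDd` abstract DATA the predicate cannot be
   proved or refuted; either define `etaDd := T.kummerTheta` over a `ThetaKummerInput` (then this file
   proves Prop. 1.4 (iii)₁ outright) or add the field `etaDd ∈ O^×_K̈ · T.kummerTheta`.

No statement of [EtTh] is asserted; hypotheses structures only quote print. Universe `Type` as in
`Setting.lean`.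
-/

noncomputable section

namespace Literature.AnabelianGeometry.EtaleTheta

open Literature.AnabelianGeometry.SemiGraphs

namespace ThetaSetting

variable {p : ℕ} [Fact p.Prime] {D : ThetaSetting p}

/-! ### 1. What `Prop14iiiKummer` says as typed -/

/-- The theta classes `O^×_K̈ · η̈^Θ` form ONE coset of the subgroup of Kummer classes of units: any
member generates the same set. [cite: MochizukiEtTh2009, Prop 1.3 p.21] -/
theorem thetaClasses_eq_of_mem (E : D.EtaleThetaData) {κ : D.H1 D.GtpYdd}
    (hκ : κ ∈ E.thetaClasses) : E.thetaClasses = {x | ∃ k ∈ E.kumUnitsYdd, x = k * κ} := by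
  obtain ⟨k₀, hk₀, rfl⟩ := hκ
  ext x
  constructor
  · rintro ⟨k, hk, rfl⟩
    exact ⟨k * k₀⁻¹, mul_mem hk (inv_mem hk₀), by rw [mul_assoc, inv_mul_cancel_left]⟩
  · rintro ⟨k, hk, rfl⟩
    exact ⟨k * k₀, mul_mem hk hk₀, by rw [mul_assoc]⟩

/-- **Prop. 1.4 (iii), first sentence, AS TYPED** (`Prop14iiiKummer E κΘ̈`: "the theta classes are the
`O^×_K̈`-translates of `κΘ̈`") is EQUIVALENT to "`κΘ̈` is a theta class" — PROVED. The printed content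
therefore lies in WHICH class `κΘ̈` is (part 2 below). [cite: MochizukiEtTh2009, Prop 1.4 (iii) p.22] -/
theorem prop14iiiKummer_iff (E : D.EtaleThetaData) (κ : D.H1 D.GtpYdd) :
    Prop14iiiKummer E κ ↔ κ ∈ E.thetaClasses := by
  constructor
  · intro h
    have h' : E.thetaClasses = {x | ∃ k ∈ E.kumUnitsYdd, x = k * κ} := h
    rw [h']
    exact ⟨1, one_mem _, (one_mul κ).symm⟩
  · exact thetaClasses_eq_of_mem E

/-- In particular the predicate holds for `κΘ̈ := η̈^Θ` itself (vacuous discharge, recorded to make the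
point of `prop14iiiKummer_iff` concrete). [cite: MochizukiEtTh2009, Prop 1.4 (iii) p.22] -/
theorem prop14iiiKummer_etaDd (E : D.EtaleThetaData) : Prop14iiiKummer E E.etaDd :=
  (prop14iiiKummer_iff E _).2 ⟨1, one_mem _, (one_mul _).symm⟩

/-! ### 2. The Kummer class of `Θ̈` in `H¹(Π^tp_Ÿ, Δ_Θ)`, via the Kummer bridge -/

variable (D) in
/-- **Geometric input for the Kummer class of `Θ̈`** (the part of [EtTh] §1 that the statement files do
not carry: "the Kummer map of FUNCTIONS"): a multiplicative group `Fn` of regular functions on the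
tempered coverings of `Ÿ` (no carrier in the tree) with its `Π^tp_X`-action by pull-back — every
function lives on a finite covering, so stabilisers are OPEN —, the function "`Θ̈ ∈ Γ(Ÿ, O^×)`"
(Prop. 1.1, Lem. 1.2; fixed by `Π^tp_Ÿ`) with a compatible system of `N`-th roots on the coverings
(p. 20: the `N`-th roots used to build `η^Θ_N`), the constants `K̈^× ⊆ Fn` with their roots in `K̄ ⊆ Fn`,
and the identification of cyclotomes `Λ(Fn) = Ẑ(1) ≅ Δ_Θ ⊆ (Π^tp_X)^Θ` ("`Δ_Θ ≅ Ẑ(1)`", p. 12) as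
continuous `Π^tp_X`-equivariant coefficients. DATA quoting print; nothing asserted.
[cite: MochizukiEtTh2009, Prop 1.4 (iii) p.22] -/
structure ThetaKummerInput where
  /-- the group of (unit) regular functions on the tempered coverings of `Ÿ` -/
  Fn : Type
  [instCommGroup : CommGroup Fn]
  /-- `Π^tp_X` acts by pull-back of functions -/
  [instAction : MulDistribMulAction D.PiTemp Fn]
  [instTop : TopologicalSpace Fn]
  /-- every function is defined on a finite covering: its stabiliser is open in `Π^tp_X` -/
  isOpen_stabilizer : ∀ f : Fn, IsOpen (MulAction.stabilizer D.PiTemp f : Set D.PiTemp)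
  /-- "`Θ̈`, regarded as a regular function on `Ÿ`" (p. 22) -/
  theta : Fn
  /-- `Θ̈` is defined on `Ÿ`: fixed by `Π^tp_Ÿ` -/
  theta_mem : theta ∈ MulAction.fixedPoints D.GtpYdd Fn
  /-- a compatible system of `N`-th roots of `Θ̈` on the coverings (p. 20) -/
  thetaRoots : RootSystem theta
  /-- the constants `K̈^× ⊆ Fn` -/
  const : (↥D.Kdd)ˣ →* Fn
  /-- constants are defined on `Ÿ` -/
  const_mem : ∀ c, const c ∈ MulAction.fixedPoints D.GtpYdd Fn
  /-- compatible roots of the constants (`K̄ ⊆ Fn`) -/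
  constRoots : ∀ c, RootSystem (const c)
  /-- `Λ(Fn) = Ẑ(1) ≅ Δ_Θ` as continuous equivariant coefficients for `Π^tp_X ↠ (Π^tp_X)^Θ ⊇ Δ_Θ` -/
  coeff : CyclotomeCoefficients D.toTheta D.DeltaTheta Fn

attribute [instance] ThetaKummerInput.instCommGroup ThetaKummerInput.instAction
  ThetaKummerInput.instTop

namespace ThetaKummerInput

variable (T : D.ThetaKummerInput)

/-- **`κΘ̈`, the Kummer class of `Θ̈`** in `H¹(Π^tp_Ÿ, Δ_Θ)` (t1's `ContH1`-valued `H1`): the continuous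
Kummer class of the root system of `Θ̈`, pushed to `Δ_Θ`-coefficients along `Λ(Fn) ≅ Δ_Θ`
(`CyclotomeCoefficients.kummerContClass`). [cite: MochizukiEtTh2009, Prop 1.4 (iii) p.22] -/
def kummerTheta : D.H1 D.GtpYdd :=
  T.coeff.kummerContClass D.GtpYdd T.thetaRoots T.theta_mem fun _ => T.isOpen_stabilizer _

/-- `κΘ̈` does not depend on the chosen compatible roots of `Θ̈`. [cite: MochizukiEtTh2009, Prop 1.4 (iii) p.22] -/
theorem kummerTheta_eq (x : RootSystem T.theta) :
    T.kummerTheta = T.coeff.kummerContClass D.GtpYdd x T.theta_mem fun _ => T.isOpen_stabilizer _ :=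
  T.coeff.kummerContClass_eq D.GtpYdd _ _ _ _ _

/-- The Kummer class in `H¹(Π^tp_Ÿ, Δ_Θ)` of a constant `c ∈ K̈^×` (via the bridge).
[cite: MochizukiEtTh2009, Prop 1.3 p.21] -/
def kummerConst (c : (↥D.Kdd)ˣ) : D.H1 D.GtpYdd :=
  T.coeff.kummerContClass D.GtpYdd (T.constRoots c) (T.const_mem c) fun _ => T.isOpen_stabilizer _

/-- `c · Θ̈` is fixed by `Π^tp_Ÿ`. [cite: MochizukiEtTh2009, Prop 1.4 (iii) p.22] -/
theorem const_mul_theta_mem (c : (↥D.Kdd)ˣ) :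
    T.const c * T.theta ∈ MulAction.fixedPoints D.GtpYdd T.Fn := fun h => by
  change (h : D.PiTemp) • (T.const c * T.theta) = T.const c * T.theta
  rw [smul_mul', show (h : D.PiTemp) • T.const c = T.const c from T.const_mem c h,
    show (h : D.PiTemp) • T.theta = T.theta from T.theta_mem h]

/-- The Kummer class of the multiple `c · Θ̈`, `c ∈ K̈^×` ("Kummer classes associated to
`O^×_K̈`-multiples of `Θ̈`", p. 22), computed with the product root system.
[cite: MochizukiEtTh2009, Prop 1.4 (iii) p.22] -/
def kummerConstMulTheta (c : (↥D.Kdd)ˣ) : D.H1 D.GtpYdd :=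
  T.coeff.kummerContClass D.GtpYdd ((T.constRoots c).mul T.thetaRoots) (T.const_mul_theta_mem c)
    fun _ => T.isOpen_stabilizer _

/-- **Key computation**: the Kummer class of `c · Θ̈` is `κ(c) · κΘ̈` (multiplicativity of continuous
Kummer classes, `kummerContClass_mul`). [cite: MochizukiEtTh2009, Prop 1.4 (iii) p.22] -/
theorem kummer_const_mul_theta (c : (↥D.Kdd)ˣ) :
    T.kummerConstMulTheta c = T.kummerConst c * T.kummerTheta :=
  T.coeff.kummerContClass_mul D.GtpYdd _ _ (T.const_mem c) T.theta_mem (T.const_mul_theta_mem c) _ _ _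

/-! ### 3. Comparison with the abstract Kummer data and the discharge -/

/-- **Compatibility of the two Kummer theories of constants**: t1's abstract injection
`K̈^× → (K̈^×)^∧ ≅ H¹(G_K̈, Δ_Θ) ↪ H¹((Π^tp_Ÿ)^Θ, Δ_Θ) → H¹(Π^tp_Ÿ, Δ_Θ)` (`kumYdd`, inflated) agrees with the
bridge's Kummer class of the constant function. (A hypothesis on the pair `(E, T)`; it is what a
construction of `KummerData` from `T` would satisfy by definition.) [cite: MochizukiEtTh2009, Prop 1.3 p.21] -/
def ConstCompat (E : D.KummerData) : Prop :=
  ∀ c : (↥D.Kdd)ˣ, D.inflTheta D.GtpYdd (E.kumYdd (E.toKddHat c)) = T.kummerConst c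

/-- Under `ConstCompat`, the subgroup `O^×_K̈ ⊆ H¹(Π^tp_Ÿ, Δ_Θ)` of t1 (`kumUnitsYdd`) consists of the
bridge's Kummer classes of the units. [cite: MochizukiEtTh2009, Prop 1.3 p.21] -/
theorem mem_kumUnitsYdd_iff {E : D.KummerData} (hT : T.ConstCompat E) (k : D.H1 D.GtpYdd) :
    k ∈ E.kumUnitsYdd ↔ ∃ c ∈ D.unitsOKdd, k = T.kummerConst c := by
  constructor
  · rintro ⟨_, ⟨c, hc, rfl⟩, rfl⟩
    exact ⟨c, hc, hT c⟩
  · rintro ⟨c, hc, rfl⟩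
    exact ⟨E.toKddHat c, ⟨c, hc, rfl⟩, hT c⟩

/-- **The Kummer classes of the `O^×_K̈`-multiples of `Θ̈` are exactly the `O^×_K̈`-translates of `κΘ̈`**
(the mathematical content of Prop. 1.4 (iii), first sentence, on the Kummer side), under `ConstCompat`.
[cite: MochizukiEtTh2009, Prop 1.4 (iii) p.22] -/
theorem kummerUnitMultiples_eq {E : D.KummerData} (hT : T.ConstCompat E) :
    {x | ∃ c ∈ D.unitsOKdd, x = T.kummerConstMulTheta c} =
      {x | ∃ k ∈ E.kumUnitsYdd, x = k * T.kummerTheta} := by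
  ext x
  constructor
  · rintro ⟨c, hc, rfl⟩
    exact ⟨T.kummerConst c, (T.mem_kumUnitsYdd_iff hT _).2 ⟨c, hc, rfl⟩, T.kummer_const_mul_theta c⟩
  · rintro ⟨k, hk, rfl⟩
    obtain ⟨c, hc, rfl⟩ := (T.mem_kumUnitsYdd_iff hT k).1 hk
    exact ⟨c, hc, (T.kummer_const_mul_theta c).symm⟩

/-- **Discharge of Prop. 1.4 (iii)₁ for the real `κΘ̈`**: if the étale theta class `η̈^Θ` of the data
`E` IS the Kummer class of `Θ̈` (p. 21: "`η̈^Θ` … the Kummer class"), then `Prop14iiiKummer E κΘ̈` holds,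
and (`kummerUnitMultiples_eq`) the theta classes are the Kummer classes of the `O^×_K̈`-multiples of
`Θ̈`. [cite: MochizukiEtTh2009, Prop 1.4 (iii) p.22] -/
theorem prop14iiiKummer_of_etaDd_eq (E : D.EtaleThetaData) (hη : E.etaDd = T.kummerTheta) :
    Prop14iiiKummer E T.kummerTheta := by
  rw [← hη]
  exact prop14iiiKummer_etaDd E

/-- Same, with `η̈^Θ` only required to be SOME unit translate of `κΘ̈` ("by abuse of the definite
article … any element of … `O^×_K̈ · η̈^Θ`", p. 21). [cite: MochizukiEtTh2009, Prop 1.4 (iii) p.22] -/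
theorem prop14iiiKummer_of_etaDd_mem (E : D.EtaleThetaData)
    (hη : ∃ k ∈ E.kumUnitsYdd, E.etaDd = k * T.kummerTheta) : Prop14iiiKummer E T.kummerTheta := by
  obtain ⟨k, hk, hη⟩ := hη
  refine (prop14iiiKummer_iff E _).2 ⟨k⁻¹, inv_mem hk, ?_⟩
  rw [hη, inv_mul_cancel_left]

/-- And then the theta classes ARE the Kummer classes of the `O^×_K̈`-multiples `c · Θ̈`.
[cite: MochizukiEtTh2009, Prop 1.4 (iii) p.22] -/
theorem thetaClasses_eq_kummerUnitMultiples (E : D.EtaleThetaData) (hT : T.ConstCompat E.toKummerData)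
    (hη : ∃ k ∈ E.kumUnitsYdd, E.etaDd = k * T.kummerTheta) :
    E.thetaClasses = {x | ∃ c ∈ D.unitsOKdd, x = T.kummerConstMulTheta c} := by
  rw [T.kummerUnitMultiples_eq hT]
  exact T.prop14iiiKummer_of_etaDd_mem E hη

end ThetaKummerInput

end ThetaSetting

end Literature.AnabelianGeometry.EtaleTheta

end
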